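import Literature.Geometry.Lorentzian.TameChartCompactnessFar
import HarnessLib

/-!
# ω-limits along time translations of an eternal, uniformly tame chart exist

Let `𝓢` be a spacetime and `Φ : B.domain → 𝓢` a smooth injective chart on the domain of a model
background `B` which is invariant under TIME TRANSLATIONS `x ↦ x + s ∂₀` (e.g. the eternal far zone
`ℝ_t × {|x| > R} = Kerr.region 0 R`), `C⁰`-pinched to `η` and with ALL `Cᵏ` sup norms of its
deviation from `η` finite over the whole domain (an eternal, uniformly asymptotically flat / tame
chart; `Φ` pushes `∂₀` to the future at one point). Then for EVERY sequence of times `tₙ` the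
pointed spacetimes `(𝓢, Φ(x₀ + tₙ ∂₀))` subconverge — in the pointed `Cᵏ_loc` sense with far charts
(`SubconvergesLocallyWithFarChartsTo`), for every `k` — to the near-Minkowski chart spacetime of a
smooth limit field on `B.domain`, the translated charts `Φ ∘ (· + tₙ ∂₀)` converging to the
identity chart of the limit:

**`Spacetime.exists_omegaLimit_timeTranslates`.** This is the local Cheeger–Gromov producer
(`TameChartCompactness*.lean`) applied to the translated charts, whose deviations are the
translates of the deviation of `Φ` (so pinching and `Cᵏ` bounds are inherited verbatim). It is the
first EXISTENCE theorem for the ω-limit / hull objects of the tame final-state routes: the hull of an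
eternal uniformly tame chart domain under time translations is nonempty (and, with the algebra of
`SpacetimeLocalConvergence*.lean`, closed and translation invariant). For the far zone this is cut
(d)+(a) of the ω-limit stubs: eternal far-zone limits exist along any `tₙ → ∞`.

(The invariance of `Kerr.region a r₀` under time translations is `Kerr.add_smul_basisVector_zero_mem_region`,
`KerrStationaryBlackHole.lean`; connectedness of its late pieces is `KerrRegionLatePiece.lean`.)

## References
* P. Petersen, *Riemannian Geometry*, 2nd ed., GTM 171, Springer 2006, Ch. 10, §3.2. [Petersen2006]
* M. T. Anderson, Cheeger–Gromov theory and applications to general relativity, 2004, §1, §5. [Anderson2004]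
-/

noncomputable section

open Set Metric Filter Topology Function TopologicalSpace
open scoped Manifold ContDiff Topology ENNReal

universe u

namespace Literature.Geometry.Lorentzian

/-! ### Time translations of a time-invariant background domain -/

namespace ModelBackground

variable (B : ModelBackground)
  (hT : ∀ (s : ℝ), ∀ x ∈ (B.domain : Set E4), x + s • E4.basisVector 0 ∈ (B.domain : Set E4))

/-- The **time translation by `s`** of the (time-invariant) domain, as a self-map of the open
submanifold `↥B.domain`. [folklore] -/
def timeShift (s : ℝ) : B.domain → B.domain := fun x ↦ ⟨x.1 + s • E4.basisVector 0, hT s x.1 x.2⟩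

/-- Unfolding lemma. [folklore] -/
@[simp]
theorem timeShift_coe (s : ℝ) (x : B.domain) :
    ((B.timeShift hT s x : B.domain) : E4) = x.1 + s • E4.basisVector 0 := rfl

include hT in
/-- The time translation is smooth. [folklore] -/
theorem contMDiff_timeShift (s : ℝ) : ContMDiff 𝓘(ℝ, E4) 𝓘(ℝ, E4) ∞ (B.timeShift hT s) := by
  rw [← ContMDiff.subtypeVal_comp_iff]
  have h : (Subtype.val ∘ B.timeShift hT s) = fun x : B.domain ↦ (x : E4) + s • E4.basisVector 0 :=
    rfl
  rw [h]
  exact (contMDiff_subtype_val.add contMDiff_const)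

/-- The time translation is injective. [folklore] -/
theorem injective_timeShift (s : ℝ) : Injective (B.timeShift hT s) := by
  intro x x' h
  have h' := congrArg Subtype.val h
  simp only [timeShift_coe, add_left_inj] at h'
  exact Subtype.ext h'

/-- **The differential of the time translation is the identity.** [folklore] -/
theorem mfderiv_timeShift_apply (s : ℝ) (x : B.domain) (v : E4) :
    mfderiv 𝓘(ℝ, E4) 𝓘(ℝ, E4) (B.timeShift hT s) x v = v := by
  have hd : MDifferentiableAt 𝓘(ℝ, E4) 𝓘(ℝ, E4) (B.timeShift hT s) x :=
    (B.contMDiff_timeShift hT s x).mdifferentiableAt (by simp)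
  have hval : MDifferentiableAt 𝓘(ℝ, E4) 𝓘(ℝ, E4) (Subtype.val : B.domain → E4) (B.timeShift hT s x) :=
    Manifold.OpenSubmanifold.mdifferentiableAt_subtype_val _
  -- differentiate `val ∘ timeShift = (· + s ∂₀) ∘ val`
  have h1 := mfderiv_comp x hval hd
  have h3 : mfderiv 𝓘(ℝ, E4) 𝓘(ℝ, E4) (Subtype.val ∘ B.timeShift hT s) x v = v := by
    rw [OpensChart.mfderiv_eq x (Subtype.val ∘ B.timeShift hT s) (fun y : E4 ↦ y + s • E4.basisVector 0)
      (fun _ ↦ rfl) (differentiableAt_id.add (differentiableAt_const _)), fderiv_add_const,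
      fderiv_fun_id]
    rfl
  have e1 : mfderiv 𝓘(ℝ, E4) 𝓘(ℝ, E4) (B.timeShift hT s) x v =
      mfderiv 𝓘(ℝ, E4) 𝓘(ℝ, E4) (Subtype.val : B.domain → E4) (B.timeShift hT s x)
        (mfderiv 𝓘(ℝ, E4) 𝓘(ℝ, E4) (B.timeShift hT s) x v) :=
    (OpensChart.mfderiv_subtypeVal_apply _ _).symm
  have e2 : mfderiv 𝓘(ℝ, E4) 𝓘(ℝ, E4) (Subtype.val : B.domain → E4) (B.timeShift hT s x)
        (mfderiv 𝓘(ℝ, E4) 𝓘(ℝ, E4) (B.timeShift hT s) x v) =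
      mfderiv 𝓘(ℝ, E4) 𝓘(ℝ, E4) (Subtype.val ∘ B.timeShift hT s) x v :=
    (DFunLike.congr_fun h1 v).symm
  exact e1.trans (e2.trans h3)

end ModelBackground

/-! ### Translated charts: deviation, pinching and bounds are inherited -/

namespace Spacetime

variable (𝓢 : Spacetime.{u} 4) (B : ModelBackground)
  (hT : ∀ (s : ℝ), ∀ x ∈ (B.domain : Set E4), x + s • E4.basisVector 0 ∈ (B.domain : Set E4))
  (Φ : B.domain → 𝓢.carrier)

/-- **The differential of a translated chart**: `d(Φ ∘ T_s)_x = dΦ_{T_s x}`. [folklore] -/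
theorem mfderiv_comp_timeShift_apply (hΦ : ContMDiff 𝓘(ℝ, E4) (𝓡 4) ∞ Φ) (s : ℝ) (x : B.domain)
    (v : E4) :
    mfderiv 𝓘(ℝ, E4) (𝓡 4) (Φ ∘ B.timeShift hT s) x v =
      mfderiv 𝓘(ℝ, E4) (𝓡 4) Φ (B.timeShift hT s x) v := by
  have h := DFunLike.congr_fun (mfderiv_comp x ((hΦ _).mdifferentiableAt (by simp))
    ((B.contMDiff_timeShift hT s x).mdifferentiableAt (by simp))) v
  exact h.trans (congrArg (mfderiv 𝓘(ℝ, E4) (𝓡 4) Φ (B.timeShift hT s x))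
    (B.mfderiv_timeShift_apply hT s x v))

/-- **The deviation of a translated chart is the translate of the deviation**, for a reference
form invariant under time translations (`η`, Schwarzschild in Kerr–Schild form, …). [folklore] -/
theorem deviation_comp_timeShift (hbil : ∀ (s : ℝ), ∀ y ∈ (B.domain : Set E4),
    B.bilin (y + s • E4.basisVector 0) = B.bilin y) (hΦ : ContMDiff 𝓘(ℝ, E4) (𝓡 4) ∞ Φ) (s : ℝ)
    (x : B.domain) :
    𝓢.deviation B (Φ ∘ B.timeShift hT s) x = 𝓢.deviation B Φ (B.timeShift hT s x) := by
  ext v w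
  rw [Spacetime.deviation_apply, Spacetime.deviation_apply,
    𝓢.mfderiv_comp_timeShift_apply B hT Φ hΦ s x v, 𝓢.mfderiv_comp_timeShift_apply B hT Φ hΦ s x w,
    B.timeShift_coe, hbil s x.1 x.2]
  rfl

/-- The same for the zero-extended deviations, as an identity of functions on `E4`. [folklore] -/
theorem deviationExtend_comp_timeShift (hbil : ∀ (s : ℝ), ∀ y ∈ (B.domain : Set E4),
    B.bilin (y + s • E4.basisVector 0) = B.bilin y) (hΦ : ContMDiff 𝓘(ℝ, E4) (𝓡 4) ∞ Φ) (s : ℝ) :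
    𝓢.deviationExtend B (Φ ∘ B.timeShift hT s) =
      fun y ↦ 𝓢.deviationExtend B Φ (y + s • E4.basisVector 0) := by
  funext y
  by_cases hy : y ∈ (B.domain : Set E4)
  · have h1 := 𝓢.deviationExtend_coe B (Φ ∘ B.timeShift hT s) ⟨y, hy⟩
    have h2 := 𝓢.deviationExtend_coe B Φ (B.timeShift hT s ⟨y, hy⟩)
    exact h1.trans ((𝓢.deviation_comp_timeShift B hT Φ hbil hΦ s ⟨y, hy⟩).trans h2.symm)
  · have hy' : y + s • E4.basisVector 0 ∉ (B.domain : Set E4) := fun h ↦ by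
      have := hT (-s) _ h
      rw [add_assoc, ← add_smul, add_neg_cancel, zero_smul, add_zero] at this
      exact hy this
    rw [𝓢.deviationExtend_of_not_mem B _ hy, 𝓢.deviationExtend_of_not_mem B _ hy']

/-- **`Cᵏ` sup norms over the invariant domain are invariant under translation of the chart.**
[folklore] -/
theorem supCkENorm_deviationExtend_comp_timeShift (hbil : ∀ (s : ℝ), ∀ y ∈ (B.domain : Set E4),
    B.bilin (y + s • E4.basisVector 0) = B.bilin y) (hΦ : ContMDiff 𝓘(ℝ, E4) (𝓡 4) ∞ Φ) (s : ℝ)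
    (k : ℕ) :
    supCkENorm (B.domain : Set E4) k (𝓢.deviationExtend B (Φ ∘ B.timeShift hT s)) =
      supCkENorm (B.domain : Set E4) k (𝓢.deviationExtend B Φ) := by
  rw [𝓢.deviationExtend_comp_timeShift B hT Φ hbil hΦ s]
  unfold supCkENorm
  refine le_antisymm (iSup₂_le fun m hm ↦ iSup₂_le fun y hy ↦ ?_)
    (iSup₂_le fun m hm ↦ iSup₂_le fun y hy ↦ ?_)
  · rw [iteratedFDeriv_comp_add_right]
    exact le_iSup₂_of_le m hm (le_iSup₂_of_le (y + s • E4.basisVector 0) (hT s y hy) le_rfl)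
  · have hy' : y + (-s) • E4.basisVector 0 ∈ (B.domain : Set E4) := hT (-s) y hy
    refine le_iSup₂_of_le m hm (le_iSup₂_of_le (y + (-s) • E4.basisVector 0) hy' ?_)
    rw [iteratedFDeriv_comp_add_right, add_assoc, ← add_smul, neg_add_cancel, zero_smul, add_zero]

/-- Pointwise form: the norm of the deviation of the translated chart at `y` is that of the
deviation at the translated point. [folklore] -/
theorem norm_deviationExtend_comp_timeShift (hbil : ∀ (s : ℝ), ∀ y ∈ (B.domain : Set E4),
    B.bilin (y + s • E4.basisVector 0) = B.bilin y) (hΦ : ContMDiff 𝓘(ℝ, E4) (𝓡 4) ∞ Φ) (s : ℝ)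
    (y : E4) :
    ‖𝓢.deviationExtend B (Φ ∘ B.timeShift hT s) y‖ =
      ‖𝓢.deviationExtend B Φ (y + s • E4.basisVector 0)‖ := by
  rw [𝓢.deviationExtend_comp_timeShift B hT Φ hbil hΦ s]

/-- **ω-limits along time translations of an eternal uniformly tame chart exist** (module
docstring). [cite: Petersen2006, Ch. 10 §3.2] -/
theorem exists_omegaLimit_timeTranslates (hconn : IsConnected (B.domain : Set E4))
    (hΦ : ContMDiff 𝓘(ℝ, E4) (𝓡 4) ∞ Φ) (hinj : Injective Φ) {x₀ : E4}
    (hx₀ : x₀ ∈ (B.domain : Set E4))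
    (hfut : 𝓢.timeOrientation.IsFutureDirected
      (mfderiv 𝓘(ℝ, E4) (𝓡 4) Φ ⟨x₀, hx₀⟩ (E4.basisVector 0)))
    {θ : ℝ} (hθ : θ < 1)
    (hpinch : ∀ y ∈ (B.domain : Set E4),
      ‖𝓢.deviationExtend (Minkowski.backgroundOn B.domain) Φ y‖ ≤ θ)
    (hbound : ∀ k : ℕ, ∃ Λ : ℝ≥0∞, Λ ≠ ⊤ ∧
      supCkENorm (B.domain : Set E4) k (𝓢.deviationExtend (Minkowski.backgroundOn B.domain) Φ) ≤ Λ)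
    (t : ℕ → ℝ) :
    ∃ (L : NearMinkowskiChart B.domain) (φ : ℕ → ℕ), StrictMono φ ∧
      (∀ y ∈ (B.domain : Set E4), ‖L.G y - Minkowski.bilin‖ ≤ θ) ∧
      (∀ (k : ℕ) (C : ℝ≥0∞),
        supCkENorm (B.domain : Set E4) k (𝓢.deviationExtend (Minkowski.backgroundOn B.domain) Φ) ≤ C →
          supCkENorm (B.domain : Set E4) k (L.G - fun _ ↦ Minkowski.bilin) ≤ C) ∧
      (∀ (k : ℕ), ∀ K ⊆ (B.domain : Set E4), IsCompact K →
        Tendsto (fun j ↦ supCkENorm K k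
          (𝓢.deviationExtend (Minkowski.backgroundOn B.domain) (Φ ∘ B.timeShift hT (t (φ j))) -
            (L.G - fun _ ↦ Minkowski.bilin))) atTop (𝓝 0)) ∧
      ∀ k : ℕ, SubconvergesLocallyWithFarChartsTo (fun _ ↦ 𝓢)
        (fun n ↦ Φ (B.timeShift hT (t n) ⟨x₀, hx₀⟩)) (L.spacetime hconn) ⟨x₀, hx₀⟩ k B
        (fun n ↦ Φ ∘ B.timeShift hT (t n)) (id : B.domain → (L.spacetime hconn).carrier) := by
  -- the translation lemmas for the MINKOWSKI background on the domain (its form is constant)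
  have hbil : ∀ (s : ℝ), ∀ y ∈ ((Minkowski.backgroundOn B.domain).domain : Set E4),
      (Minkowski.backgroundOn B.domain).bilin (y + s • E4.basisVector 0) =
        (Minkowski.backgroundOn B.domain).bilin y := fun _ _ _ ↦ rfl
  have hΨ : ∀ n, ContMDiff 𝓘(ℝ, E4) (𝓡 4) ∞ (Φ ∘ B.timeShift hT (t n)) := fun n ↦
    hΦ.comp (B.contMDiff_timeShift hT (t n))
  have hsup : ∀ n (k : ℕ), supCkENorm (B.domain : Set E4) k
      (𝓢.deviationExtend (Minkowski.backgroundOn B.domain) (Φ ∘ B.timeShift hT (t n))) =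
      supCkENorm (B.domain : Set E4) k (𝓢.deviationExtend (Minkowski.backgroundOn B.domain) Φ) :=
    fun n k ↦ 𝓢.supCkENorm_deviationExtend_comp_timeShift (Minkowski.backgroundOn B.domain) hT Φ hbil
      hΦ (t n) k
  have hpinch' : ∀ n, ∀ y ∈ (B.domain : Set E4),
      ‖𝓢.deviationExtend (Minkowski.backgroundOn B.domain) (Φ ∘ B.timeShift hT (t n)) y‖ ≤ θ :=
    fun n y hy ↦ (𝓢.norm_deviationExtend_comp_timeShift (Minkowski.backgroundOn B.domain) hT Φ hbil
      hΦ (t n) y).trans_le (hpinch _ (hT _ y hy))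
  -- orientation: future at `x₀` ⇒ future at every point of the connected domain ⇒ at the translates
  have hfut' : ∀ n, 𝓢.timeOrientation.IsFutureDirected
      (mfderiv 𝓘(ℝ, E4) (𝓡 4) (Φ ∘ B.timeShift hT (t n)) ⟨x₀, hx₀⟩ (E4.basisVector 0)) := by
    intro n
    rw [𝓢.mfderiv_comp_timeShift_apply B hT Φ hΦ (t n) ⟨x₀, hx₀⟩]
    exact 𝓢.isFutureDirected_mfderiv_basisVector_zero_of_norm_deviationExtend_lt_one
      hconn.isPreconnected Φ hΦ (fun y hy ↦ (hpinch y hy).trans_lt hθ) hfut _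
  obtain ⟨L, φ, hφ, h1, h2, h3, h4⟩ := exists_nearMinkowskiChart_subconvergesLocallyWithFarChartsTo
    (𝓢ₙ := fun _ ↦ 𝓢) (pₙ := fun n ↦ Φ (B.timeShift hT (t n) ⟨x₀, hx₀⟩)) B hconn hx₀
    (fun n ↦ Φ ∘ B.timeShift hT (t n)) hΨ (fun n ↦ hinj.comp (B.injective_timeShift hT (t n)))
    (fun _ ↦ rfl) hfut' hθ hpinch' fun k ↦ (hbound k).imp fun Λ hΛ ↦
      ⟨hΛ.1, fun n ↦ (hsup n k).trans_le hΛ.2⟩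
  exact ⟨L, φ, hφ, h1, fun k C hC ↦ h2 k C fun n ↦ (hsup n k).trans_le hC, h3, h4⟩

end Spacetime

end Literature.Geometry.Lorentzian

end
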